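import Summits.HodgeConjecture.HodgeConjecture.Theorems.CurveNetMordellWeilCurveNetExists
import Literature.AlgebraicGeometry.Motives.CurveNetExistenceProofs
import Literature.AlgebraicGeometry.HodgeTheory.ComplexConjugationHolds

/-!
# Route `CurveNetMordellWeil` — support item `CurveNetExists` (stmt-HodgeConjecture-2788), closed

GENERIC CURVE NETS EXIST.  The tree theorem `curveNetExists_of_nonempty_hodgeModel_of_nonempty_curveNet`
(`Theorems/CurveNetMordellWeilCurveNetExists.lean`) proves the item CONDITIONALLY on two Literature named
facts: Hodge models of smooth projective varieties (`nonempty_hodgeModel`) and the existence of curve nets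
(`Motives.nonempty_curveNet`: blowing up the base locus of `n` general sections of `𝒪_X(d)` gives a smooth
projective `X' → X` with a surjective morphism to `ℙ^{n-1}`).  Both are now DISCHARGED in the Literature
library (`nonempty_hodgeModel_holds`, `nonempty_curveNet_holds`), so the item closes unconditionally.
No definition, no named-fact hypothesis, no sorry.
-/

set_option linter.dupNamespace false

noncomputable section

namespace Summit.HodgeConjecture.HodgeConjecture.Theorems

/-- **Item stmt-HodgeConjecture-2788 (`CurveNetExists`, route `CurveNetMordellWeil`)**, unconditionally:
for `X` smooth projective of dimension `n ≥ 2` and `m + 1 = n` there are a smooth projective `X'`,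
`σ : X' → X` and a surjective `pr : X' → ℙ^m` with the rational `(q,q)`-classes of `X` inside `σ_*` of
those of `X'` — the tree's conditional theorem fed with the landed discharges `nonempty_hodgeModel_holds`
and `nonempty_curveNet_holds`.  The type is literally the route decl
`Summit.HodgeConjecture.HodgeConjecture.Theses.CurveNetMordellWeil.CurveNetExists`.
[cite: VoisinHodgeII2003, §2.1] [cite: Hartshorne1977, II Thm. 8.18 and II.7] -/
theorem curveNetMordellWeil_curveNetExists_proof :
    Summit.HodgeConjecture.HodgeConjecture.Theses.CurveNetMordellWeil.CurveNetExists :=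
  curveNetExists_of_nonempty_hodgeModel_of_nonempty_curveNet
    (fun _ _ => Literature.AlgebraicGeometry.HodgeTheory.nonempty_hodgeModel_holds)
    Literature.AlgebraicGeometry.Motives.nonempty_curveNet_holds

end Summit.HodgeConjecture.HodgeConjecture.Theorems

end
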